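import Mathlib
import HarnessLib
import Summits.NavierStokesRegularity.NavierStokesRegularity.Theorems.HalfSpaceWindowDoorCirculationCarryingRigidityFarConeLiouville
import Summits.NavierStokesRegularity.NavierStokesRegularity.Theorems.HalfSpaceWindowDoorCirculationCarryingRigidityTransportSweeping
import Summits.NavierStokesRegularity.NavierStokesRegularity.Theorems.HalfSpaceWindowDoorCirculationCarryingRigidityTransportRigidity
import Summits.NavierStokesRegularity.NavierStokesRegularity.Theorems.AxisTwistDoorAveragedConeLiouvilleCircleLimits

/-!
# Route `HalfSpaceWindowDoor`, crux `CirculationCarryingRigidity` (stmt-NavierStokesRegularity-25311) —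
# line `cone_sweep`, TRANSPORT form, Step 4: `HemisphereLiouvilleE3` REDUCES to the one-sided far-circle transport bound

LEAD ns-hsw-p1 g9, `--supports stmt-NavierStokesRegularity-25311 --as helper`; card `Cruxes/…/Lines/cone_sweep.md`.  The end of the line:

**Theorem (`inner_curl_e3_eq_zero_of_transportBound`).**  Let `v` be a door-class profile (`‖v(s)‖_∞ ≤ C/√(−s)`, continuity, Oseen–Duhamel,
divergence-free) with `⟪curl v, e₃⟫ ≥ 0`, and suppose that on the circles `S(r,z)` about the `e₃`-axis of radius `r ≥ R₀√(−s)` the flux of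
vertical vorticity INTO the circle is at most `B/√(−s)` times the vertical vorticity ON the circle:
`−T(r,z,s) = ∮_{S(r,z)}(ω_r v₃ − v_r ω₃) dl ≤ (B/√(−s)) ∮_{S(r,z)} ω₃ dl` (any `B, R₀ ≥ 0`, any `C`).  Then `v` is POLOIDAL: `⟪curl v, e₃⟫ ≡ 0`.
NO cone; the azimuthal vorticity, the signs of `v₃`, `ω_r` elsewhere and the whole parabolic tube are free.  Proof: `S₀ = sup Γ < ∞`
(`circ_le_const_of_transport`); `S₀ = 0` ⇒ every plane of every slice is saturated at radius `0` ⇒ poloidal (`inner_curl_e3_eq_zero_of_circ_nonpos`);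
`S₀ > 0` ⇒ the sweeping lemma (`circ_le_sSup_of_transport`) puts near-maximal discs on the tube boundary `r = R₁√(−s_n)`, the Navier–Stokes zooms about
the axis points `(0,0,z_n)` (class-, sign- and `Γ`-covariant) converge by F3 to a door-class limit whose plane `{x₃ = 0}` at time `−1` is saturated
by `D(R₁, 0)` with value `S₀`, and PLANE RIGIDITY (`circ_eq_zero_of_saturated_plane`, line analyticity) empties that plane: `S₀ = 0`, contradiction.
The transport bound is used for `v` only — never for the zooms or the limit.  Corollaries: `enemy_transport_fails` (census reading: a
circulation-carrying closed-hemisphere profile has, for every `B, R₀`, a far circle through which vertical-vorticity flux enters faster than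
`(B/√(−s))∮ω₃`), `not_isBackwardSingularPoint_of_transportBound` (crux format) and the BY-NAME REDUCTION `hemisphereLiouvilleE3_of_transportBound`
of the open stub.  Supersedes the cone / far-cone / radial-cone theorems (p683554, p684672, p686578), whose hypotheses imply the transport bound.
WHAT THIS IS NOT: not about NS regularity; HYPOTHETICAL profiles; `HemisphereLiouvilleE3` itself stays OPEN.  No item is closed by this file.
-/

noncomputable section

-- the summit and its single sub-problem share the name (CONVENTIONS §1), as in every Theorems file
set_option linter.dupNamespace false

namespace Summit.NavierStokesRegularity.NavierStokesRegularity.Theorems.HalfSpaceWindowDoorCirculationCarryingRigidityTransportLiouville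

open MeasureTheory Set Function Filter Topology InnerProductSpace
open scoped RealInnerProductSpace InnerProductSpace
open Literature.Analysis Literature.Analysis.UnboundedOperators
open Literature.Analysis.FluidPDE hiding eR
open Summit.NavierStokesRegularity.NavierStokesRegularity.Theses.HalfSpaceWindowDoor
open Summit.NavierStokesRegularity.NavierStokesRegularity.Theorems.HalfSpaceWindowDoorCirculationCarryingRigidityDefs
  (InDoorClass SignE3 e3 HemisphereLiouvilleE3)
open Summit.NavierStokesRegularity.NavierStokesRegularity.Theorems.AxisTwistDoorAveragedConeLiouvilleDefs
  (cylPt eT eR circ vortCirc circleTerm)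
open Summit.NavierStokesRegularity.NavierStokesRegularity.Theorems.AveragedConeLiouville.CircMonotone (circ_zero circ_nonneg)
open Summit.NavierStokesRegularity.NavierStokesRegularity.Theorems.AveragedConeLiouville.CircleLimits (tendsto_circ)
open Summit.NavierStokesRegularity.NavierStokesRegularity.Theorems
  (exists_tendsto_of_isTypeIAncientMild_seq isTypeIAncientMild_zoom zoom_apply)
open Summit.NavierStokesRegularity.NavierStokesRegularity.Theorems.HalfSpaceWindowDoorCirculationCarryingRigidityGaussExtremal
  (inDoorClass_of_isTypeIAncientMild)
open Summit.NavierStokesRegularity.NavierStokesRegularity.Theorems.HalfSpaceWindowDoorCirculationCarryingRigidityHorizontalVorticityFloor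
  (tendsto_curl_of_tendsto_fderiv)
open Summit.NavierStokesRegularity.NavierStokesRegularity.Theorems.PoloidalWindowDoorPoloidalWindowRigidityWindow
  (isTypeIAncientMild_of_class)
open Summit.NavierStokesRegularity.NavierStokesRegularity.Theorems.HalfSpaceWindowDoorCirculationCarryingRigidityConeFluxSubsolution
  (signE3_atd contDiff_one_slice tube_bddAbove)
open Summit.NavierStokesRegularity.NavierStokesRegularity.Theorems.HalfSpaceWindowDoorCirculationCarryingRigidityTransportSweeping
  (circ_le_sSup_of_transport circ_le_const_of_transport)
open Summit.NavierStokesRegularity.NavierStokesRegularity.Theorems.HalfSpaceWindowDoorCirculationCarryingRigidityTransportRigidity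
  (circ_eq_zero_of_saturated_plane inner_curl_e3_eq_zero_of_circ_nonpos)
open Summit.NavierStokesRegularity.NavierStokesRegularity.Theorems.HalfSpaceWindowDoorCirculationCarryingRigidityConeLiouville
  (axisPt_add_smul_cylPt circ_zoom_axis)
open Summit.NavierStokesRegularity.NavierStokesRegularity.Theorems.HalfSpaceWindowDoorCirculationCarryingRigidityFarConeLiouville
  (vortCirc_zoom_axis)

variable {C : ℝ} {v : ℝ → EuclideanSpace ℝ (Fin 3) → EuclideanSpace ℝ (Fin 3)}

/-! ### Covariance of the transport bound (recorded for the census; not needed below) -/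

/-- The circle term under the zoom about `(0,0,ζ)`: `T[c • v(c²·,(0,0,ζ)+c·)](r,z,s) = c²·T[v](c r, ζ + c z, c² s)`. -/
theorem circleTerm_zoom_axis (c ζ : ℝ) (u : ℝ → EuclideanSpace ℝ (Fin 3) → EuclideanSpace ℝ (Fin 3)) (r z s : ℝ) :
    circleTerm (c • stPull (c ^ 2) c 0 (cylPt 0 0 ζ) u) r z s = c ^ 2 * circleTerm u (c * r) (ζ + c * z) (c ^ 2 * s) := by
  unfold circleTerm
  rw [← intervalIntegral.integral_const_mul]
  refine intervalIntegral.integral_congr fun θ _ => ?_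
  simp only [zoom_apply, curl_smul_stPull, zero_add, axisPt_add_smul_cylPt, inner_smul_left, RCLike.conj_to_real]
  ring

/-- **The far-field transport bound is invariant under the Navier–Stokes zooms about axis points** (`c > 0`). -/
theorem transportBound_zoom {B R₀ : ℝ} {u : ℝ → EuclideanSpace ℝ (Fin 3) → EuclideanSpace ℝ (Fin 3)}
    (hu : ∀ s < 0, ∀ r : ℝ, R₀ * Real.sqrt (-s) ≤ r → ∀ z : ℝ, -circleTerm u r z s ≤ B / Real.sqrt (-s) * vortCirc u r z s)
    {c : ℝ} (hc : 0 < c) (ζ : ℝ) :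
    ∀ s < 0, ∀ r : ℝ, R₀ * Real.sqrt (-s) ≤ r → ∀ z : ℝ,
      -circleTerm (c • stPull (c ^ 2) c 0 (cylPt 0 0 ζ) u) r z s ≤
        B / Real.sqrt (-s) * vortCirc (c • stPull (c ^ 2) c 0 (cylPt 0 0 ζ) u) r z s := by
  intro s hs r hr z
  rw [circleTerm_zoom_axis, vortCirc_zoom_axis]
  have hs' : c ^ 2 * s < 0 := mul_neg_of_pos_of_neg (pow_pos hc 2) hs
  have hsq : Real.sqrt (-(c ^ 2 * s)) = c * Real.sqrt (-s) := by
    rw [show -(c ^ 2 * s) = c ^ 2 * (-s) by ring, Real.sqrt_mul' _ (neg_pos.2 hs).le, Real.sqrt_sq hc.le]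
  have hsq0 : 0 < Real.sqrt (-s) := Real.sqrt_pos.2 (neg_pos.2 hs)
  have hr' : R₀ * Real.sqrt (-(c ^ 2 * s)) ≤ c * r := by rw [hsq]; nlinarith [hr, hc]
  have h := hu _ hs' _ hr' (ζ + c * z)
  rw [hsq] at h
  have h2 := mul_le_mul_of_nonneg_left h (pow_pos hc 2).le
  have e : c ^ 2 * (B / (c * Real.sqrt (-s)) * vortCirc u (c * r) (ζ + c * z) (c ^ 2 * s)) =
      B / Real.sqrt (-s) * (c * vortCirc u (c * r) (ζ + c * z) (c ^ 2 * s)) := by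
    field_simp
  linarith [h2, e]

/-! ### The theorem -/

/-- **`HemisphereLiouvilleE3` UNDER THE FAR-FIELD TRANSPORT BOUND (all `C`, `B`, `R₀`).**  A closed-hemisphere door-class profile with
`−∮_{S(r,z)}(v_rω₃ − ω_r v₃) dl ≤ (B/√(−s))∮_{S(r,z)}ω₃ dl` on every circle about the `e₃`-axis of radius `≥ R₀√(−s)` is poloidal. -/
theorem inner_curl_e3_eq_zero_of_transportBound (hv : InDoorClass C v) (hsign : SignE3 v) {B : ℝ} (hB : 0 ≤ B)
    {R₀ : ℝ} (hR₀ : 0 ≤ R₀)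
    (htr : ∀ s < 0, ∀ r : ℝ, R₀ * Real.sqrt (-s) ≤ r → ∀ z : ℝ, -circleTerm v r z s ≤ B / Real.sqrt (-s) * vortCirc v r z s) :
    ∀ s < 0, ∀ y, ⟪curl (v s) y, e3⟫ = 0 := by
  have hA : IsTypeIAncientMild C v := isTypeIAncientMild_of_class hv.1 hv.2.1 hv.2.2.1 hv.2.2.2
  set R₁ : ℝ := 4 * B + R₀ + 1 with hR₁
  have hC : 0 ≤ C := hA.nonneg
  have hR₁0 : 0 ≤ R₁ := by positivity
  -- the total set of circulations and its supremum `S₀`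
  set Tot : Set ℝ := {m | ∃ s : ℝ, s < 0 ∧ ∃ r : ℝ, 0 ≤ r ∧ ∃ z : ℝ, m = circ v r z s} with hTot
  have hTotle : ∀ m ∈ Tot, m ≤ 2 * Real.pi * (R₁ * C) := by
    rintro m ⟨s, hs, r, hr, z, rfl⟩
    exact circ_le_const_of_transport hv hsign hB hR₀ htr hs hr z
  have hTotbdd : BddAbove Tot := ⟨_, hTotle⟩
  have hmem : ∀ s < 0, ∀ r : ℝ, 0 ≤ r → ∀ z, circ v r z s ∈ Tot := fun s hs r hr z => ⟨s, hs, r, hr, z, rfl⟩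
  have hTotne : Tot.Nonempty := ⟨_, hmem (-1) (by norm_num) 0 le_rfl 0⟩
  set S₀ : ℝ := sSup Tot with hS₀
  have hleS : ∀ s < 0, ∀ r : ℝ, 0 ≤ r → ∀ z, circ v r z s ≤ S₀ := fun s hs r hr z => le_csSup hTotbdd (hmem s hs r hr z)
  have hm1 : (-1 : ℝ) < 0 := by norm_num
  rcases le_or_gt S₀ 0 with hS | hS
  · -- every plane of every slice is saturated at radius `0`
    intro s hs
    exact inner_curl_e3_eq_zero_of_circ_nonpos hv hsign hs fun r hr z => (hleS s hs r hr z).trans hS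
  -- `S₀ > 0`: near-maximal TUBE-BOUNDARY discs at some `(s_n, z_n)`
  exfalso
  have hnear : ∀ n : ℕ, ∃ p : ℝ × ℝ, p.1 < 0 ∧ S₀ - 1 / ((n : ℝ) + 1) < circ v (R₁ * Real.sqrt (-p.1)) p.2 p.1 := by
    intro n
    have hε : S₀ - 1 / ((n : ℝ) + 1) < S₀ := by
      have : (0 : ℝ) < 1 / ((n : ℝ) + 1) := by positivity
      linarith
    obtain ⟨m, ⟨s, hs, r, hr, z, rfl⟩, hm⟩ := exists_lt_of_lt_csSup hTotne hε
    -- the sweeping lemma at `s₁ = s`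
    have hsw := circ_le_sSup_of_transport hv hsign hB hR₀ htr hs le_rfl hr z
    obtain ⟨hTbdd, -⟩ := tube_bddAbove hv hR₁0 hs
    have hTne : {m' : ℝ | ∃ s' : ℝ, s' ≤ s ∧ ∃ z' : ℝ, m' = circ v (R₁ * Real.sqrt (-s')) z' s'}.Nonempty :=
      ⟨_, s, le_rfl, 0, rfl⟩
    obtain ⟨m', ⟨s', hs', z', rfl⟩, hm'⟩ := exists_lt_of_lt_csSup hTne (lt_of_lt_of_le hm hsw)
    exact ⟨(s', z'), lt_of_le_of_lt hs' hs, hm'⟩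
  choose p hp1 hp2 using hnear
  set sn : ℕ → ℝ := fun n => (p n).1 with hsn
  set zn : ℕ → ℝ := fun n => (p n).2 with hzn
  set lam : ℕ → ℝ := fun n => Real.sqrt (-sn n) with hlam
  have hlam0 : ∀ n, 0 < lam n := fun n => Real.sqrt_pos.2 (neg_pos.2 (hp1 n))
  have hlam2 : ∀ n, lam n ^ 2 = -sn n := fun n => Real.sq_sqrt (neg_pos.2 (hp1 n)).le
  -- the zooms about `(0,0,z_n)` with factor `λ_n = √(−s_n)`
  set w : ℕ → ℝ → EuclideanSpace ℝ (Fin 3) → EuclideanSpace ℝ (Fin 3) :=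
    fun n => lam n • stPull (lam n ^ 2) (lam n) 0 (cylPt 0 0 (zn n)) v with hw
  have hwcl : ∀ n, IsTypeIAncientMild C (w n) := fun n => isTypeIAncientMild_zoom hA (hlam0 n) _
  have hwcirc : ∀ n r z s, circ (w n) r z s = circ v (lam n * r) (zn n + lam n * z) (lam n ^ 2 * s) := fun n r z s =>
    circ_zoom_axis (lam n) (zn n) v r z s
  have hwR₁ : ∀ n, circ (w n) R₁ 0 (-1) = circ v (R₁ * Real.sqrt (-sn n)) (zn n) (sn n) := by
    intro n
    rw [hwcirc, mul_zero, add_zero, hlam2, mul_comm (lam n) R₁]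
    congr 1
    ring
  have hwle : ∀ n, ∀ σ < 0, ∀ r : ℝ, 0 ≤ r → ∀ z, circ (w n) r z σ ≤ S₀ := by
    intro n σ hσ r hr z
    rw [hwcirc]
    refine hleS _ ?_ _ (mul_nonneg (hlam0 n).le hr) _
    exact mul_neg_of_pos_of_neg (pow_pos (hlam0 n) 2) hσ
  have hwsign : ∀ n, SignE3 (w n) := by
    intro n σ hσ y
    have hcurl : curl (w n σ) y =
        (lam n * lam n) • curl (v (0 + lam n ^ 2 * σ)) (cylPt 0 0 (zn n) + lam n • y) :=
      curl_smul_stPull (lam n) (lam n ^ 2) (lam n) 0 (cylPt 0 0 (zn n)) v σ y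
    rw [hcurl, real_inner_smul_left]
    refine mul_nonneg (mul_self_nonneg _) (hsign _ ?_ _)
    rw [zero_add]; exact mul_neg_of_pos_of_neg (pow_pos (hlam0 n) 2) hσ
  -- compactness
  obtain ⟨φ, hφ, W, hW, hpt, hptG, hlu, hluG⟩ := exists_tendsto_of_isTypeIAncientMild_seq C hwcl
  have hWdoor : InDoorClass C W := inDoorClass_of_isTypeIAncientMild hW
  have hWsign : SignE3 W := by
    intro σ hσ y
    have hc : Tendsto (fun j => ⟪curl (w (φ j) σ) y, e3⟫) atTop (𝓝 ⟪curl (W σ) y, e3⟫) :=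
      (tendsto_curl_of_tendsto_fderiv (hptG σ hσ y)).inner tendsto_const_nhds
    exact ge_of_tendsto' hc fun j => hwsign (φ j) σ hσ y
  have hclim : ∀ σ < 0, ∀ r z, Tendsto (fun j => circ (w (φ j)) r z σ) atTop (𝓝 (circ W r z σ)) := fun σ hσ r z =>
    tendsto_circ (fun j => (hwcl (φ j)).continuous_slice hσ) (hW.continuous_slice hσ) (hlu σ hσ) r z
  -- the saturated disc of the limit
  have hWR₁ : circ W R₁ 0 (-1) = S₀ := by
    refine tendsto_nhds_unique (hclim (-1) hm1 R₁ 0) ?_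
    have hlow : Tendsto (fun j => S₀ - 1 / ((φ j : ℝ) + 1)) atTop (𝓝 S₀) := by
      have h1 : Tendsto (fun j => 1 / ((φ j : ℝ) + 1)) atTop (𝓝 0) := by
        have hφ' : Tendsto (fun j => ((φ j : ℕ) : ℝ)) atTop atTop :=
          tendsto_natCast_atTop_atTop.comp hφ.tendsto_atTop
        have : Tendsto (fun j => ((φ j : ℝ) + 1)) atTop atTop := tendsto_atTop_add_const_right _ 1 hφ'
        exact tendsto_const_nhds.div_atTop this
      simpa using tendsto_const_nhds.sub h1
    refine tendsto_of_tendsto_of_tendsto_of_le_of_le hlow tendsto_const_nhds (fun j => ?_) fun j => ?_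
    · rw [hwR₁]; exact (hp2 (φ j)).le
    · exact hwle (φ j) (-1) hm1 R₁ hR₁0 0
  have hWle : ∀ r : ℝ, 0 ≤ r → ∀ z, circ W r z (-1) ≤ S₀ := fun r hr z =>
    le_of_tendsto' (hclim (-1) hm1 r z) fun j => hwle (φ j) (-1) hm1 r hr z
  -- plane rigidity empties the saturated plane of the limit
  have h0 := circ_eq_zero_of_saturated_plane hWdoor hWsign hm1 hR₁0 hWR₁ (fun r hr => hWle r hr 0) R₁
  linarith

/-- **CENSUS READING (enemy form).**  A circulation-carrying (`⟪curl v(σ)(y), e₃⟫ > 0` somewhere) closed-hemisphere door-class profile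
VIOLATES EVERY FAR-FIELD TRANSPORT BOUND about the axis: for all `B ≥ 0`, `R₀ ≥ 0` there are `s < 0`, `r ≥ R₀√(−s)` and `z` with
`−∮_{S(r,z)}(v_rω₃ − ω_r v₃) dl > (B/√(−s)) ∮_{S(r,z)} ω₃ dl` — vertical-vorticity flux enters some far circle faster than `B/√(−s)` (carried by
the vertical velocity along nearly-horizontal vortex lines: `ω_r v₃ > 0` dominating).  By translation / rotation covariance of the class the same
holds about every axis. -/
theorem enemy_transport_fails (hv : InDoorClass C v) (hsign : SignE3 v) (hpos : ∃ σ < 0, ∃ y, 0 < ⟪curl (v σ) y, e3⟫)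
    {B : ℝ} (hB : 0 ≤ B) {R₀ : ℝ} (hR₀ : 0 ≤ R₀) :
    ∃ s < 0, ∃ r : ℝ, R₀ * Real.sqrt (-s) ≤ r ∧ ∃ z : ℝ, B / Real.sqrt (-s) * vortCirc v r z s < -circleTerm v r z s := by
  by_contra h
  push Not at h
  obtain ⟨σ, hσ, y, hy⟩ := hpos
  have h0 := inner_curl_e3_eq_zero_of_transportBound hv hsign hB hR₀ (fun s hs r hr z => h s hs r hr z) σ hσ y
  exact hy.ne' h0

/-- **Crux format.**  In the situation of the crux `CirculationCarryingRigidity` specialised to `e = e₃` (closed hemisphere, circulation-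
carrying), the far-field transport bound about the axis is contradictory — in particular the apex is not backward-singular. -/
theorem not_isBackwardSingularPoint_of_transportBound (hv : InDoorClass C v) (hsign : SignE3 v)
    (hpos : ∃ σ < 0, ∃ y, 0 < ⟪curl (v σ) y, e3⟫) {B : ℝ} (hB : 0 ≤ B) {R₀ : ℝ} (hR₀ : 0 ≤ R₀)
    (htr : ∀ s < 0, ∀ r : ℝ, R₀ * Real.sqrt (-s) ≤ r → ∀ z : ℝ, -circleTerm v r z s ≤ B / Real.sqrt (-s) * vortCirc v r z s) :
    ¬ IsBackwardSingularPoint v 0 := by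
  intro _
  obtain ⟨s, hs, r, hr, z, hlt⟩ := enemy_transport_fails hv hsign hpos hB hR₀
  exact (not_lt.2 (htr s hs r hr z)) hlt

/-- **BY-NAME REDUCTION of the open stub.**  If every closed-hemisphere profile of the door class obeys the far-field transport bound about
the `e₃`-axis for SOME `B, R₀ ≥ 0`, then `HemisphereLiouvilleE3` holds. -/
theorem hemisphereLiouvilleE3_of_transportBound
    (H : ∀ (C : ℝ) (v : ℝ → EuclideanSpace ℝ (Fin 3) → EuclideanSpace ℝ (Fin 3)), InDoorClass C v → SignE3 v →
      ∃ B : ℝ, 0 ≤ B ∧ ∃ R₀ : ℝ, 0 ≤ R₀ ∧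
        ∀ s < 0, ∀ r : ℝ, R₀ * Real.sqrt (-s) ≤ r → ∀ z : ℝ, -circleTerm v r z s ≤ B / Real.sqrt (-s) * vortCirc v r z s) :
    HemisphereLiouvilleE3 := by
  intro C v hrate hcont hmild hdiv hnn
  have hv : InDoorClass C v := ⟨hrate, hcont, hmild, hdiv⟩
  have hsign : SignE3 v := hnn
  obtain ⟨B, hB, R₀, hR₀, htr⟩ := H C v hv hsign
  exact inner_curl_e3_eq_zero_of_transportBound hv hsign hB hR₀ htr

end Summit.NavierStokesRegularity.NavierStokesRegularity.Theorems.HalfSpaceWindowDoorCirculationCarryingRigidityTransportLiouville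

end
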